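import Summits.QuantumFields.YangMills.Theorems.BalabanUVNodesN20BlockCaricatureExactCriterion

/-!
# BalabanUVNodes ∕ N20·N19′·N21 — THE INDEPENDENT-BLOCK CARICATURE WITH NON-EXCHANGEABLE BLOCKS (FILE Q): product-Bernoulli class weights with PER-BLOCK rates
# `p_{K,i}`, `q_{K,i}`; the ℓ¹ distance of the two runs' configuration laws is at most `2·Σ_i |q_{K,i} − p_{K,i}|` (hybrid argument) and, in the RARE window
# (`Σ_i p_{K,i} ≤ ½`, `Σ_i q_{K,i} ≤ ½`), at least `½·Σ_i |q_{K,i} − p_{K,i}|`; hence node U5's bundled binder list `HybridNE7` (K3 stub 2's face triple) holds on the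
# caricature for SOME dials as soon as `Σ_K Σ_i |q_{K,i} − p_{K,i}| < ∞` (any block counts, any regime), and in the rare window IFF that letter holds

Cell `pub-ymgap` (HUMAN RULING D-0062 Track A; work-bound push D-0149, director-ym №197), width seat `pub-ymgap-dag-n20-w1` (gen 7) on node N20 = NE7b; key item of this
seat's payload K3⁷ `SpineGivenEndpointR13SepCoPH` = stmt-QuantumFields-20544 (ASIDE since rev 28∕29; lineage of K3⁸ `SpineGivenEndpointR13SepCoPHV` = stmt-QuantumFields-27366,
skeleton v6 b4e55110ab73e679 UNTOUCHED; `--kind proof --supports 20544 --as helper`, MIS-KEY rule R463 (4)(a)); COUNT-NEUTRAL.  Bus: CLAIM-21 ∕ INTENT-26 (INBOX l.37929).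
THEOREMS ONLY (0 def ∕ instance ∕ notation ∕ sorry); imports this seat's FILE D `…N20BlockCaricatureExactCriterion` ONLY (through it FILE A and dag-n20-w4 p609004, CONSUMED BY NAME).

WHY.  FILES A–P of this seat (g5∕g6) priced K3 stub 2's face triple on the card's caricature with EXCHANGEABLE blocks (`n_K` blocks, ONE rate `p_K` under run A, ONE `q_K`
under run B: class laws `Bin(n_K, p_K)` vs `Bin(n_K, q_K)`, the block COUNT sufficient (FILE F), closed form `Σ_K min(1, n_K|q_K − p_K| ∕ max(1, σ_K)) < ∞` (FILE K)).  At the record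
the blocks of any key are NOT exchangeable (different levels of the window, different background fields), so a reading — if ever produced — meets PER-BLOCK rates `p_{K,i}, q_{K,i}`.
Here the class weights are the PRODUCT-BERNOULLI configuration weights `w_p(S) = (∏_{i∈S} p_i)·∏_{i∈U∖S} (1 − p_i)` on `S ⊆ U` (spelled inline; no `def`).  Without the symmetry:
the total is `1` (`Finset.prod_add`); the affinity is still MULTIPLICATIVE (★ `affinity_prodConfig_eq_prod`); the ℓ¹ distance of the two configuration laws obeys the HYBRID bound
★★ `l1_prodConfig_le_two_mul_blockDiscrepancy` `Σ_S |w_q(S) − w_p(S)| ≤ 2·Σ_{i∈U} |q_i − p_i|` (swap the rates one block at a time: `Finset.induction_on` + `sum_powerset_insert`), and in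
the RARE WINDOW `Σ_U p ≤ ½`, `Σ_U q ≤ ½` conversely ★★ `blockDiscrepancy_le_two_mul_l1_prodConfig_of_rare` `Σ_{i∈U}|q_i − p_i| ≤ 2·Σ_S|w_q − w_p|` (the one-sided union events
«some block with `p_i < q_i` is large-field» and its mirror are class sets with gap `∏(1−p_i) − ∏(1−q_i) ≥ ½·Σ(q_i − p_i)`; every class-set gap is `≤ ½ℓ¹`, FILE A).  Along `K` (§2,
carriers `(range n_K).powerset`): FILE D's EXACT ℓ¹ criterion re-issued for per-block rates (★★★ `exists_hybridNE7_inhomCaricature_iff_summable_l1`); ★★★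
`exists_hybridNE7_inhomCaricature_of_summable_blockDiscrepancy` — `Σ_K Σ_{i<n_K} |q_{K,i} − p_{K,i}| < ∞` gives the dials for ANY block counts in ANY regime; ★★★★
`exists_hybridNE7_inhomCaricature_iff_summable_blockDiscrepancy_of_rare` — in the rare window the dials exist IFF that letter holds.  §3: iid dictionary (constant rates give FILE A's
weights and FILE M's letter `n_K|q_K − p_K|`) and an A6 witness.
LOCATED READING (for the plan's booked window key `kr := wkey`, CRIT-1, cdisprove-to-be; caricature currency, nothing at the record): at a WINDOW key the caricature's class-law half of
stub 2 is served by the ℓ¹(K × blocks) summability of the two runs' PER-BLOCK large-field-probability discrepancies — the (YG)-type two-run letter LOCALISED TO ONE COARSE BLOCK AT A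
TIME, first order, no exchangeability, no count statistic — and where the window's blocks are rarely large-field under both runs nothing weaker serves.  The bulk ∕ inhomogeneous
regime has NO closed form in these letters (Le Cam's `H²`–`H` gap is attained at both ends already for exchangeable blocks, FILE G) — not attempted.

HONEST FRAMING.  [folklore] finite-sum probability ∕ real analysis on a CARICATURE (independent, NON-identically distributed blocks; product Bernoulli class weights — the card's
simplification, widened); nothing read at the record (`classSet₁₃ ∕ weightA₁₃ ∕ weightB₁₃` untouched; (LS)∕(XG′)∕(SAT′) and the regime AT THE RECORD UNDECIDED); proves NO estimate of
Bałaban's; refutes NO registered stub; nothing of Bałaban's asserted or instantiated.  NE7 ∕ NE7b ∕ NE7c NOT PRINTED for `d = 4`, NOT proved; N19 ∕ N20 ∕ N21 NOT discharged; K3⁸ ∕ K3⁷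
OPEN; counts unmoved (typed 28∕28 · discharged 5∕27); no count claim.  One finite `𝕋⁴_{L^K}` programme at fixed `ε = L^{−K}`, Bałaban AS PRINTED; the YM mass gap (Clay) is NOT proved
by any of this — R4 closes the conditional finite-𝕋⁴ rung `BalabanLadder.UV` only; NOT ℝ⁴, NOT OS.  No decl carries a cite tag (sources bookkeeping only: [Balaban1988Convergent] (2.18)
p.257; [Balaban1989LargeFieldII] (1.80) p.384).
-/

noncomputable section

open Finset Filter Topology
open Literature.MathematicalPhysics.QuantumFieldTheory.Balaban1983to89
open Literature.MathematicalPhysics.QuantumFieldTheory.Balaban1983to89.T4MatchingAssembly (HybridNE7)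
open Summit.QuantumFields.BalabanUV.T4Continuum.Spine.NE7
open Summit.QuantumFields.YangMills.BalabanUVNodes.N20BlockCaricatureAffinity (abs_sub_le_half_sum_abs)
open Summit.QuantumFields.YangMills.BalabanUVNodes.N20BlockCaricatureExactCriterion (sum_abs_sub_eq_two_mul_hahnGap hahnGap_lt_one_of_pos)
open Summit.QuantumFields.YangMills.BalabanUVNodes.N20HybridClassLawCharacterisation (exists_tvRadius_of_hybridNE7 exists_hybridNE7_of_target_of_classLawTV)

namespace Summit.QuantumFields.YangMills.BalabanUVNodes.N20InhomogeneousBlockCaricature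

/-! ## §1 Product-Bernoulli configuration weights with per-block rates on a finite block set `U` -/

section ProductWeights

variable {ι : Type*} [DecidableEq ι]

/-- The configuration weights `w_p(S) = (∏_{i∈S} p_i)·∏_{i∈U∖S}(1 − p_i)` of independent blocks with PER-BLOCK large-field probabilities `p_i` sum to `1` over the configurations
`S ⊆ U` (`∏_i (p_i + (1 − p_i)) = 1`, `Finset.prod_add`). [folklore] -/
theorem sum_prodConfig_eq_one (U : Finset ι) (p : ι → ℝ) :
    ∑ S ∈ U.powerset, (∏ i ∈ S, p i) * ∏ i ∈ U \ S, (1 - p i) = 1 := by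
  rw [← Finset.prod_add]
  exact Finset.prod_eq_one fun i _ => by ring

/-- Configuration weights are non-negative for rates in `[0, 1]`. [folklore] -/
theorem prodConfig_nonneg {U : Finset ι} {p : ι → ℝ} (hp : ∀ i ∈ U, 0 ≤ p i ∧ p i ≤ 1) {S : Finset ι} (hS : S ⊆ U) :
    0 ≤ (∏ i ∈ S, p i) * ∏ i ∈ U \ S, (1 - p i) :=
  mul_nonneg (Finset.prod_nonneg fun i hi => (hp i (hS hi)).1) (Finset.prod_nonneg fun i hi => sub_nonneg.2 (hp i (Finset.mem_sdiff.1 hi).1).2)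

/-- Configuration weights are positive for rates in `(0, 1)`. [folklore] -/
theorem prodConfig_pos {U : Finset ι} {p : ι → ℝ} (hp : ∀ i ∈ U, 0 < p i ∧ p i < 1) {S : Finset ι} (hS : S ⊆ U) :
    0 < (∏ i ∈ S, p i) * ∏ i ∈ U \ S, (1 - p i) :=
  mul_pos (Finset.prod_pos fun i hi => (hp i (hS hi)).1) (Finset.prod_pos fun i hi => sub_pos.2 (hp i (Finset.mem_sdiff.1 hi).1).2)

/-- Enlarging the block set by one block `a ∉ U`: a configuration NOT containing `a` picks up the factor `1 − p_a`. [bookkeeping] -/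
theorem prodConfig_insert_of_notMem {U : Finset ι} {a : ι} (ha : a ∉ U) (p : ι → ℝ) {S : Finset ι} (hS : S ⊆ U) :
    (∏ i ∈ S, p i) * ∏ i ∈ insert a U \ S, (1 - p i) = (1 - p a) * ((∏ i ∈ S, p i) * ∏ i ∈ U \ S, (1 - p i)) := by
  have haS : a ∉ S := fun h => ha (hS h)
  rw [Finset.insert_sdiff_of_notMem U haS, Finset.prod_insert (fun h => ha (Finset.mem_sdiff.1 h).1)]
  ring

/-- … and the configuration `insert a S` picks up the factor `p_a`. [bookkeeping] -/
theorem prodConfig_insert_insert {U : Finset ι} {a : ι} (ha : a ∉ U) (p : ι → ℝ) {S : Finset ι} (hS : S ⊆ U) :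
    (∏ i ∈ insert a S, p i) * ∏ i ∈ insert a U \ insert a S, (1 - p i) = p a * ((∏ i ∈ S, p i) * ∏ i ∈ U \ S, (1 - p i)) := by
  have haS : a ∉ S := fun h => ha (hS h)
  rw [Finset.prod_insert haS, Finset.insert_sdiff_insert, Finset.sdiff_insert_of_notMem ha]
  ring

/-- ★ **THE AFFINITY IS STILL MULTIPLICATIVE** [folklore]: `Σ_{S ⊆ U} √(w_p(S)·w_q(S)) = ∏_{i∈U} (√(p_i q_i) + √((1 − p_i)(1 − q_i)))` — the Bhattacharyya affinity of two
product-Bernoulli configuration laws is the product of the per-block affinities, exchangeable or not (FILE A `affinity_config_eq_pow` is the constant-rate case). -/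
theorem affinity_prodConfig_eq_prod (U : Finset ι) {p q : ι → ℝ} (hp : ∀ i ∈ U, 0 ≤ p i ∧ p i ≤ 1) (hq : ∀ i ∈ U, 0 ≤ q i ∧ q i ≤ 1) :
    ∑ S ∈ U.powerset, Real.sqrt (((∏ i ∈ S, p i) * ∏ i ∈ U \ S, (1 - p i)) * ((∏ i ∈ S, q i) * ∏ i ∈ U \ S, (1 - q i))) =
      ∏ i ∈ U, (Real.sqrt (p i * q i) + Real.sqrt ((1 - p i) * (1 - q i))) := by
  induction U using Finset.induction_on with
  | empty => simp
  | insert a U ha IH =>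
    have hpU : ∀ i ∈ U, 0 ≤ p i ∧ p i ≤ 1 := fun i hi => hp i (Finset.mem_insert_of_mem hi)
    have hqU : ∀ i ∈ U, 0 ≤ q i ∧ q i ≤ 1 := fun i hi => hq i (Finset.mem_insert_of_mem hi)
    have hpa := hp a (Finset.mem_insert_self a U)
    have hqa := hq a (Finset.mem_insert_self a U)
    rw [Finset.sum_powerset_insert ha, Finset.prod_insert ha, ← IH hpU hqU, add_mul, Finset.mul_sum, Finset.mul_sum, ← Finset.sum_add_distrib,
      ← Finset.sum_add_distrib]
    refine Finset.sum_congr rfl fun S hS => ?_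
    have hS' : S ⊆ U := Finset.mem_powerset.1 hS
    have hX : 0 ≤ (∏ i ∈ S, p i) * ∏ i ∈ U \ S, (1 - p i) := prodConfig_nonneg hpU hS'
    have hY : 0 ≤ (∏ i ∈ S, q i) * ∏ i ∈ U \ S, (1 - q i) := prodConfig_nonneg hqU hS'
    rw [prodConfig_insert_of_notMem ha p hS', prodConfig_insert_of_notMem ha q hS', prodConfig_insert_insert ha p hS', prodConfig_insert_insert ha q hS']
    have e1 : (1 - p a) * ((∏ i ∈ S, p i) * ∏ i ∈ U \ S, (1 - p i)) * ((1 - q a) * ((∏ i ∈ S, q i) * ∏ i ∈ U \ S, (1 - q i))) =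
        ((1 - p a) * (1 - q a)) * (((∏ i ∈ S, p i) * ∏ i ∈ U \ S, (1 - p i)) * ((∏ i ∈ S, q i) * ∏ i ∈ U \ S, (1 - q i))) := by ring
    have e2 : p a * ((∏ i ∈ S, p i) * ∏ i ∈ U \ S, (1 - p i)) * (q a * ((∏ i ∈ S, q i) * ∏ i ∈ U \ S, (1 - q i))) =
        (p a * q a) * (((∏ i ∈ S, p i) * ∏ i ∈ U \ S, (1 - p i)) * ((∏ i ∈ S, q i) * ∏ i ∈ U \ S, (1 - q i))) := by ring
    rw [e1, e2, Real.sqrt_mul (mul_nonneg (sub_nonneg.2 hpa.2) (sub_nonneg.2 hqa.2)), Real.sqrt_mul (mul_nonneg hpa.1 hqa.1)]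
    ring

/-- **MARGINAL OF A BLOCK SUBSET** [folklore]: the configurations avoiding a block subset `I ⊆ U` («every block of `I` small-field») carry total weight `∏_{i∈I} (1 − p_i)` — the
blocks of `U ∖ I` integrate out to `1`. -/
theorem sum_prodConfig_powerset_sdiff (U : Finset ι) {I : Finset ι} (hI : I ⊆ U) (p : ι → ℝ) :
    ∑ S ∈ (U \ I).powerset, (∏ i ∈ S, p i) * ∏ i ∈ U \ S, (1 - p i) = ∏ i ∈ I, (1 - p i) := by
  have key : ∀ S ∈ (U \ I).powerset, ∏ i ∈ U \ S, (1 - p i) = (∏ i ∈ I, (1 - p i)) * ∏ i ∈ (U \ I) \ S, (1 - p i) := by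
    intro S hS
    have hS' : S ⊆ U \ I := Finset.mem_powerset.1 hS
    have hunion : U \ S = I ∪ (U \ I) \ S := by
      ext i
      have h1 : i ∈ I → i ∈ U := fun h => hI h
      have h2 : i ∈ S → i ∈ U ∧ i ∉ I := fun h => Finset.mem_sdiff.1 (hS' h)
      simp only [Finset.mem_sdiff, Finset.mem_union]
      tauto
    have hdisj : Disjoint I ((U \ I) \ S) :=
      Finset.disjoint_left.2 fun i hiI hi2 => (Finset.mem_sdiff.1 (Finset.mem_sdiff.1 hi2).1).2 hiI
    rw [hunion, Finset.prod_union hdisj]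
  calc ∑ S ∈ (U \ I).powerset, (∏ i ∈ S, p i) * ∏ i ∈ U \ S, (1 - p i)
      = ∑ S ∈ (U \ I).powerset, (∏ i ∈ I, (1 - p i)) * ((∏ i ∈ S, p i) * ∏ i ∈ (U \ I) \ S, (1 - p i)) :=
        Finset.sum_congr rfl fun S hS => by rw [key S hS]; ring
    _ = (∏ i ∈ I, (1 - p i)) * 1 := by rw [← Finset.mul_sum, sum_prodConfig_eq_one]
    _ = ∏ i ∈ I, (1 - p i) := mul_one _

/-- The ℓ¹ distance of the two configuration laws is symmetric in the runs. [bookkeeping] -/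
theorem l1_prodConfig_comm (U : Finset ι) (p q : ι → ℝ) :
    ∑ S ∈ U.powerset, |(∏ i ∈ S, p i) * ∏ i ∈ U \ S, (1 - p i) - (∏ i ∈ S, q i) * ∏ i ∈ U \ S, (1 - q i)| =
      ∑ S ∈ U.powerset, |(∏ i ∈ S, q i) * ∏ i ∈ U \ S, (1 - q i) - (∏ i ∈ S, p i) * ∏ i ∈ U \ S, (1 - p i)| :=
  Finset.sum_congr rfl fun _ _ => abs_sub_comm _ _

/-- ★★ **THE HYBRID BOUND** [folklore]: `Σ_{S ⊆ U} |w_q(S) − w_p(S)| ≤ 2·Σ_{i∈U} |q_i − p_i|` — the ℓ¹ distance of two product-Bernoulli configuration laws is at most twice that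
of the rate vectors (swap the rates one block at a time: `TV ≤ Σ_i TV_i` for product measures; induction on the block set with `Finset.sum_powerset_insert`). -/
theorem l1_prodConfig_le_two_mul_blockDiscrepancy (U : Finset ι) {p q : ι → ℝ} (hp : ∀ i ∈ U, 0 ≤ p i ∧ p i ≤ 1) (hq : ∀ i ∈ U, 0 ≤ q i ∧ q i ≤ 1) :
    ∑ S ∈ U.powerset, |(∏ i ∈ S, q i) * ∏ i ∈ U \ S, (1 - q i) - (∏ i ∈ S, p i) * ∏ i ∈ U \ S, (1 - p i)| ≤ 2 * ∑ i ∈ U, |q i - p i| := by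
  induction U using Finset.induction_on with
  | empty => simp
  | insert a U ha IH =>
    have hpU : ∀ i ∈ U, 0 ≤ p i ∧ p i ≤ 1 := fun i hi => hp i (Finset.mem_insert_of_mem hi)
    have hqU : ∀ i ∈ U, 0 ≤ q i ∧ q i ≤ 1 := fun i hi => hq i (Finset.mem_insert_of_mem hi)
    have hpa := hp a (Finset.mem_insert_self a U)
    have hqa := hq a (Finset.mem_insert_self a U)
    rw [Finset.sum_powerset_insert ha, Finset.sum_insert ha, ← Finset.sum_add_distrib]
    have key : ∀ S ∈ U.powerset,
        |(∏ i ∈ S, q i) * ∏ i ∈ insert a U \ S, (1 - q i) - (∏ i ∈ S, p i) * ∏ i ∈ insert a U \ S, (1 - p i)| +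
          |(∏ i ∈ insert a S, q i) * ∏ i ∈ insert a U \ insert a S, (1 - q i) - (∏ i ∈ insert a S, p i) * ∏ i ∈ insert a U \ insert a S, (1 - p i)| ≤
        |(∏ i ∈ S, q i) * ∏ i ∈ U \ S, (1 - q i) - (∏ i ∈ S, p i) * ∏ i ∈ U \ S, (1 - p i)| + 2 * |q a - p a| * ((∏ i ∈ S, p i) * ∏ i ∈ U \ S, (1 - p i)) := by
      intro S hS
      have hS' : S ⊆ U := Finset.mem_powerset.1 hS
      have hX : 0 ≤ (∏ i ∈ S, p i) * ∏ i ∈ U \ S, (1 - p i) := prodConfig_nonneg hpU hS'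
      rw [prodConfig_insert_of_notMem ha q hS', prodConfig_insert_of_notMem ha p hS', prodConfig_insert_insert ha q hS', prodConfig_insert_insert ha p hS']
      set X := (∏ i ∈ S, p i) * ∏ i ∈ U \ S, (1 - p i)
      set Y := (∏ i ∈ S, q i) * ∏ i ∈ U \ S, (1 - q i)
      have e1 : (1 - q a) * Y - (1 - p a) * X = (1 - q a) * (Y - X) + (p a - q a) * X := by ring
      have e2 : q a * Y - p a * X = q a * (Y - X) + (q a - p a) * X := by ring
      rw [e1, e2]
      calc |(1 - q a) * (Y - X) + (p a - q a) * X| + |q a * (Y - X) + (q a - p a) * X|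
          ≤ (|(1 - q a) * (Y - X)| + |(p a - q a) * X|) + (|q a * (Y - X)| + |(q a - p a) * X|) := add_le_add (abs_add_le _ _) (abs_add_le _ _)
        _ = |Y - X| + 2 * |q a - p a| * X := by
            rw [abs_mul (1 - q a) (Y - X), abs_mul (p a - q a) X, abs_mul (q a) (Y - X), abs_mul (q a - p a) X, abs_of_nonneg (sub_nonneg.2 hqa.2),
              abs_of_nonneg hqa.1, abs_of_nonneg hX, abs_sub_comm (p a) (q a)]
            ring
    calc _ ≤ ∑ S ∈ U.powerset, (|(∏ i ∈ S, q i) * ∏ i ∈ U \ S, (1 - q i) - (∏ i ∈ S, p i) * ∏ i ∈ U \ S, (1 - p i)| +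
          2 * |q a - p a| * ((∏ i ∈ S, p i) * ∏ i ∈ U \ S, (1 - p i))) := Finset.sum_le_sum key
      _ = ∑ S ∈ U.powerset, |(∏ i ∈ S, q i) * ∏ i ∈ U \ S, (1 - q i) - (∏ i ∈ S, p i) * ∏ i ∈ U \ S, (1 - p i)| + 2 * |q a - p a| := by
          rw [Finset.sum_add_distrib, ← Finset.mul_sum, sum_prodConfig_eq_one, mul_one]
      _ ≤ 2 * (|q a - p a| + ∑ i ∈ U, |q i - p i|) := by linarith [IH hpU hqU]

/-- **TELESCOPING A PRODUCT GAP FROM BELOW** [folklore]: for `0 ≤ y_i ≤ x_i` with `y_i ≤ 1` on `I`, `(Σ_{i∈I} (x_i − y_i))·∏_{i∈I} y_i ≤ ∏_{i∈I} x_i − ∏_{i∈I} y_i`. -/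
theorem sum_sub_mul_prod_le_prod_sub_prod (I : Finset ι) {x y : ι → ℝ} (hy0 : ∀ i ∈ I, 0 ≤ y i) (hy1 : ∀ i ∈ I, y i ≤ 1) (hxy : ∀ i ∈ I, y i ≤ x i) :
    (∑ i ∈ I, (x i - y i)) * ∏ i ∈ I, y i ≤ ∏ i ∈ I, x i - ∏ i ∈ I, y i := by
  induction I using Finset.induction_on with
  | empty => simp
  | insert a I ha IH =>
    have hy0I : ∀ i ∈ I, 0 ≤ y i := fun i hi => hy0 i (Finset.mem_insert_of_mem hi)
    have hy1I : ∀ i ∈ I, y i ≤ 1 := fun i hi => hy1 i (Finset.mem_insert_of_mem hi)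
    have hxyI : ∀ i ∈ I, y i ≤ x i := fun i hi => hxy i (Finset.mem_insert_of_mem hi)
    have h := IH hy0I hy1I hxyI
    have hya0 := hy0 a (Finset.mem_insert_self a I)
    have hya1 := hy1 a (Finset.mem_insert_self a I)
    have hxya := hxy a (Finset.mem_insert_self a I)
    rw [Finset.sum_insert ha, Finset.prod_insert ha, Finset.prod_insert ha]
    set P := ∏ i ∈ I, x i
    set Q := ∏ i ∈ I, y i
    set s := ∑ i ∈ I, (x i - y i)
    have hQ : 0 ≤ Q := Finset.prod_nonneg hy0I
    have hs : 0 ≤ s := Finset.sum_nonneg fun i hi => sub_nonneg.2 (hxyI i hi)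
    have hsQ : 0 ≤ s * Q := mul_nonneg hs hQ
    have h1 : x a * (Q + s * Q) ≤ x a * P := mul_le_mul_of_nonneg_left (by linarith) (hya0.trans hxya)
    nlinarith [mul_nonneg (sub_nonneg.2 hxya) hQ, mul_nonneg (sub_nonneg.2 hxya) hsQ, mul_nonneg (sub_nonneg.2 hya1) (mul_nonneg (sub_nonneg.2 hxya) hQ)]

/-- ★★ **THE RARE-WINDOW LOWER BOUND** [folklore]: if under EITHER run at most half a large-field block is expected (`Σ_{i∈U} p_i ≤ ½`, `Σ_{i∈U} q_i ≤ ½`), then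
`Σ_{i∈U} |q_i − p_i| ≤ 2·Σ_{S⊆U} |w_q(S) − w_p(S)|`: the configurations avoiding `I₊ = {p_i < q_i}` form a class set with run-A-minus-run-B gap `∏_{I₊}(1 − p_i) − ∏_{I₊}(1 − q_i) ≥
(Σ_{I₊}(q_i − p_i))·∏_{I₊}(1 − q_i) ≥ ½·Σ_{I₊}(q_i − p_i)` (Weierstrass), mirror-wise for `{q_i ≤ p_i}`; every class-set gap is `≤ ½ℓ¹` (FILE A). -/
theorem blockDiscrepancy_le_two_mul_l1_prodConfig_of_rare (U : Finset ι) {p q : ι → ℝ} (hp : ∀ i ∈ U, 0 ≤ p i ∧ p i ≤ 1) (hq : ∀ i ∈ U, 0 ≤ q i ∧ q i ≤ 1)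
    (hpU : ∑ i ∈ U, p i ≤ 1 / 2) (hqU : ∑ i ∈ U, q i ≤ 1 / 2) :
    ∑ i ∈ U, |q i - p i| ≤ 2 * ∑ S ∈ U.powerset, |(∏ i ∈ S, q i) * ∏ i ∈ U \ S, (1 - q i) - (∏ i ∈ S, p i) * ∏ i ∈ U \ S, (1 - p i)| := by
  have hW : ∀ (I : Finset ι) (r : ι → ℝ), (∀ i ∈ I, 0 ≤ r i ∧ r i ≤ 1) → 1 - ∑ i ∈ I, r i ≤ ∏ i ∈ I, (1 - r i) := by
    intro I r hr
    induction I using Finset.induction_on with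
    | empty => simp
    | insert a I ha IH =>
      have hrI : ∀ i ∈ I, 0 ≤ r i ∧ r i ≤ 1 := fun i hi => hr i (Finset.mem_insert_of_mem hi)
      have hra := hr a (Finset.mem_insert_self a I)
      rw [Finset.sum_insert ha, Finset.prod_insert ha]
      have h := IH hrI
      have h2 : (1 - r a) * (1 - ∑ i ∈ I, r i) ≤ (1 - r a) * ∏ i ∈ I, (1 - r i) := mul_le_mul_of_nonneg_left h (sub_nonneg.2 hra.2)
      nlinarith [Finset.sum_nonneg fun i hi => (hrI i hi).1, hra.1]
  -- the one-sided bound for an ordered pair of rate vectors `r ≤ r'` on a block subset `I ⊆ U` with `Σ_I r' ≤ ½`: `Σ_I (r' − r) ≤ ℓ¹(w_r, w_{r'})`, via the event `(U ∖ I).powerset`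
  have hside : ∀ (r r' : ι → ℝ), (∀ i ∈ U, 0 ≤ r i ∧ r i ≤ 1) → (∀ i ∈ U, 0 ≤ r' i ∧ r' i ≤ 1) → ∀ I ⊆ U, (∀ i ∈ I, r i ≤ r' i) → ∑ i ∈ I, r' i ≤ 1 / 2 →
      ∑ i ∈ I, (r' i - r i) ≤ ∑ S ∈ U.powerset, |(∏ i ∈ S, r' i) * ∏ i ∈ U \ S, (1 - r' i) - (∏ i ∈ S, r i) * ∏ i ∈ U \ S, (1 - r i)| := by
    intro r r' hr hr' I hI hle hI2
    have hgap : (∑ i ∈ I, (r' i - r i)) * (1 / 2) ≤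
        ∑ S ∈ (U \ I).powerset, (∏ i ∈ S, r i) * ∏ i ∈ U \ S, (1 - r i) - ∑ S ∈ (U \ I).powerset, (∏ i ∈ S, r' i) * ∏ i ∈ U \ S, (1 - r' i) := by
      rw [sum_prodConfig_powerset_sdiff U hI r, sum_prodConfig_powerset_sdiff U hI r']
      have htel := sum_sub_mul_prod_le_prod_sub_prod I (x := fun i => 1 - r i) (y := fun i => 1 - r' i)
        (fun i hi => sub_nonneg.2 (hr' i (hI hi)).2) (fun i hi => by linarith [(hr' i (hI hi)).1]) (fun i hi => by linarith [hle i hi])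
      have e : ∑ i ∈ I, ((1 - r i) - (1 - r' i)) = ∑ i ∈ I, (r' i - r i) := Finset.sum_congr rfl fun i _ => by ring
      rw [e] at htel
      have hs : 0 ≤ ∑ i ∈ I, (r' i - r i) := Finset.sum_nonneg fun i hi => sub_nonneg.2 (hle i hi)
      have hWI := hW I r' fun i hi => hr' i (hI hi)
      have hhalf : (1 : ℝ) / 2 ≤ ∏ i ∈ I, (1 - r' i) := by linarith
      calc (∑ i ∈ I, (r' i - r i)) * (1 / 2) ≤ (∑ i ∈ I, (r' i - r i)) * ∏ i ∈ I, (1 - r' i) := mul_le_mul_of_nonneg_left hhalf hs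
        _ ≤ _ := htel
    have hhalfl1 := abs_sub_le_half_sum_abs U.powerset (a := fun S => (∏ i ∈ S, r' i) * ∏ i ∈ U \ S, (1 - r' i))
      (b := fun S => (∏ i ∈ S, r i) * ∏ i ∈ U \ S, (1 - r i)) (by rw [sum_prodConfig_eq_one, sum_prodConfig_eq_one])
      (S := (U \ I).powerset) (Finset.powerset_mono.2 Finset.sdiff_subset)
    rw [l1_prodConfig_comm U r r'] at hhalfl1
    linarith [le_abs_self (∑ S ∈ (U \ I).powerset, (∏ i ∈ S, r i) * ∏ i ∈ U \ S, (1 - r i) - ∑ S ∈ (U \ I).powerset, (∏ i ∈ S, r' i) * ∏ i ∈ U \ S, (1 - r' i))]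
  have hsplit := (Finset.sum_filter_add_sum_filter_not U (fun i => p i < q i) (fun i => |q i - p i|)).symm
  have hplus : ∑ i ∈ U.filter (fun i => p i < q i), |q i - p i| = ∑ i ∈ U.filter (fun i => p i < q i), (q i - p i) :=
    Finset.sum_congr rfl fun i hi => abs_of_pos (sub_pos.2 (Finset.mem_filter.1 hi).2)
  have hminus : ∑ i ∈ U.filter (fun i => ¬ p i < q i), |q i - p i| = ∑ i ∈ U.filter (fun i => ¬ p i < q i), (p i - q i) :=
    Finset.sum_congr rfl fun i hi => by rw [abs_sub_comm]; exact abs_of_nonneg (sub_nonneg.2 (not_lt.1 (Finset.mem_filter.1 hi).2))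
  have h1 := hside p q hp hq (U.filter (fun i => p i < q i)) (Finset.filter_subset _ _) (fun i hi => (Finset.mem_filter.1 hi).2.le)
    ((Finset.sum_le_sum_of_subset_of_nonneg (Finset.filter_subset _ U) fun i hi _ => (hq i hi).1).trans hqU)
  have h2 := hside q p hq hp (U.filter (fun i => ¬ p i < q i)) (Finset.filter_subset _ _) (fun i hi => not_lt.1 (Finset.mem_filter.1 hi).2)
    ((Finset.sum_le_sum_of_subset_of_nonneg (Finset.filter_subset _ U) fun i hi _ => (hp i hi).1).trans hpU)
  rw [l1_prodConfig_comm U p q] at h2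
  rw [hsplit, hplus, hminus]
  linarith

/-- Two weight functions with equal totals on `T` whose every class-set gap is `≤ ρ` are `2ρ`-close in ℓ¹ (read the gap on the Hahn set, FILE D §1). [folklore] -/
theorem sum_abs_sub_le_two_mul_of_classSetGap_le {κ : Type*} (T : Finset κ) {a b : κ → ℝ} (hab : ∑ i ∈ T, a i = ∑ i ∈ T, b i) {ρ : ℝ}
    (hρ : ∀ S ⊆ T, |∑ i ∈ S, b i - ∑ i ∈ S, a i| ≤ ρ) : ∑ i ∈ T, |b i - a i| ≤ 2 * ρ := by
  classical
  rw [sum_abs_sub_eq_two_mul_hahnGap T hab]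
  linarith [hρ _ (Finset.filter_subset (fun i => a i < b i) T),
    le_abs_self (∑ i ∈ T.filter (fun i => a i < b i), b i - ∑ i ∈ T.filter (fun i => a i < b i), a i)]

/-- Half the ℓ¹ distance of the two configuration laws is STRICTLY below one once every run-A rate lies in `(0, 1)` (all run-A weights positive; FILE D §1). [folklore] -/
theorem half_l1_prodConfig_lt_one (U : Finset ι) {p q : ι → ℝ} (hp : ∀ i ∈ U, 0 < p i ∧ p i < 1) (hq : ∀ i ∈ U, 0 ≤ q i ∧ q i ≤ 1) :
    (∑ S ∈ U.powerset, |(∏ i ∈ S, q i) * ∏ i ∈ U \ S, (1 - q i) - (∏ i ∈ S, p i) * ∏ i ∈ U \ S, (1 - p i)|) / 2 < 1 := by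
  classical
  rw [sum_abs_sub_eq_two_mul_hahnGap U.powerset (a := fun S => (∏ i ∈ S, p i) * ∏ i ∈ U \ S, (1 - p i))
    (b := fun S => (∏ i ∈ S, q i) * ∏ i ∈ U \ S, (1 - q i)) (by rw [sum_prodConfig_eq_one, sum_prodConfig_eq_one])]
  have h := hahnGap_lt_one_of_pos U.powerset (a := fun S => (∏ i ∈ S, p i) * ∏ i ∈ U \ S, (1 - p i))
    (b := fun S => (∏ i ∈ S, q i) * ∏ i ∈ U \ S, (1 - q i)) (fun S hS => prodConfig_pos hp (Finset.mem_powerset.1 hS))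
    (fun S hS => prodConfig_nonneg hq (Finset.mem_powerset.1 hS)) (sum_prodConfig_eq_one U q)
  linarith

end ProductWeights

/-! ## §2 Along `K`: the exact ℓ¹ criterion for per-block rates, the block-discrepancy letter, and the rare window -/

section AlongK

variable (n : ℕ → ℕ) (p q : ℕ → ℕ → ℝ)

/-- ★★★ **THE EXACT CRITERION, PER-BLOCK RATES** [folklore ∕ bookkeeping] (FILE D §3 without exchangeability): for run-A rates `p_{K,i} ∈ (0, 1)`, run-B rates `q_{K,i} ∈ [0, 1]`,
SOME `(Bad, W, shA, shB, Wsh, δ)` give node U5's `HybridNE7` on the carriers `(range n_K).powerset` with the product-Bernoulli weights (any `vol`, `l₀ ≥ 0`) IFF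
`Σ_K Σ_{S ⊆ range n_K} |w_{q_K}(S) − w_{p_K}(S)| < ∞` ((⇒) dag-n20-w4's `exists_tvRadius_of_hybridNE7` on the Hahn sets; (⇐) radius `½ℓ¹_K < 1`, free target, `exists_hybridNE7_of_target_of_classLawTV`). -/
theorem exists_hybridNE7_inhomCaricature_iff_summable_l1 (hp : ∀ K, ∀ i ∈ Finset.range (n K), 0 < p K i ∧ p K i < 1)
    (hq : ∀ K, ∀ i ∈ Finset.range (n K), 0 ≤ q K i ∧ q K i ≤ 1) {l₀ : ℝ} (hl₀ : 0 ≤ l₀) (vol : ℝ) :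
    (∃ (Bad : ℕ → ℝ → Finset (Finset ℕ)) (W : ℕ → ℝ) (shA shB : ℕ → ℝ → Finset ℕ → ℝ) (Wsh δ : ℕ → ℝ),
      HybridNE7 l₀ vol (fun K => (Finset.range (n K)).powerset) (fun K _ S => (∏ i ∈ S, p K i) * ∏ i ∈ Finset.range (n K) \ S, (1 - p K i))
        (fun K _ S => (∏ i ∈ S, q K i) * ∏ i ∈ Finset.range (n K) \ S, (1 - q K i)) Bad W shA shB Wsh δ) ↔
    Summable fun K => ∑ S ∈ (Finset.range (n K)).powerset,
      |(∏ i ∈ S, q K i) * ∏ i ∈ Finset.range (n K) \ S, (1 - q K i) - (∏ i ∈ S, p K i) * ∏ i ∈ Finset.range (n K) \ S, (1 - p K i)| := by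
  classical
  have hp' : ∀ K, ∀ i ∈ Finset.range (n K), 0 ≤ p K i ∧ p K i ≤ 1 := fun K i hi => ⟨(hp K i hi).1.le, (hp K i hi).2.le⟩
  have hZA : ∀ (K : ℕ) (t : ℝ), |t| ≤ l₀ → 0 < ∑ S ∈ (Finset.range (n K)).powerset, (∏ i ∈ S, p K i) * ∏ i ∈ Finset.range (n K) \ S, (1 - p K i) :=
    fun K t _ => by rw [sum_prodConfig_eq_one]; exact one_pos
  have hZB : ∀ (K : ℕ) (t : ℝ), |t| ≤ l₀ → 0 < ∑ S ∈ (Finset.range (n K)).powerset, (∏ i ∈ S, q K i) * ∏ i ∈ Finset.range (n K) \ S, (1 - q K i) :=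
    fun K t _ => by rw [sum_prodConfig_eq_one]; exact one_pos
  constructor
  · rintro ⟨Bad, W, shA, shB, Wsh, δ, h⟩
    obtain ⟨ρ, -, hρs, hρ⟩ := exists_tvRadius_of_hybridNE7 h hZA hZB
    refine Summable.of_nonneg_of_le (fun K => Finset.sum_nonneg fun S _ => abs_nonneg _) (fun K => ?_) (hρs.mul_left 2)
    refine sum_abs_sub_le_two_mul_of_classSetGap_le _ (by rw [sum_prodConfig_eq_one, sum_prodConfig_eq_one]) fun 𝒮 h𝒮 => ?_
    have hK := hρ K 0 (by simpa using hl₀) 𝒮 h𝒮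
    simp only [sum_prodConfig_eq_one, div_one] at hK
    rwa [abs_sub_comm] at hK
  · intro hsum
    have hT : Target vol l₀ (fun _ => 0) (fun _ _ => (1 : ℝ)) := ⟨fun K => ⟨0, fun t _ => by simp⟩, summable_zero⟩
    obtain ⟨shA, shB, h⟩ := exists_hybridNE7_of_target_of_classLawTV (vol := vol) (T := fun K => (Finset.range (n K)).powerset)
      (A := fun K _ S => (∏ i ∈ S, p K i) * ∏ i ∈ Finset.range (n K) \ S, (1 - p K i))
      (B := fun K _ S => (∏ i ∈ S, q K i) * ∏ i ∈ Finset.range (n K) \ S, (1 - q K i)) hl₀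
      (fun K t _ S hS => prodConfig_nonneg (hp' K) (Finset.mem_powerset.1 hS)) (fun K t _ S hS => prodConfig_nonneg (hq K) (Finset.mem_powerset.1 hS)) hZA hZB
      (Z := fun _ _ => (1 : ℝ)) (fun K t _ => (sum_prodConfig_eq_one (Finset.range (n K)) (p K)).symm)
      (fun K t _ => (sum_prodConfig_eq_one (Finset.range (n K)) (q K)).symm) hT
      (ρ := fun K => (∑ S ∈ (Finset.range (n K)).powerset,
        |(∏ i ∈ S, q K i) * ∏ i ∈ Finset.range (n K) \ S, (1 - q K i) - (∏ i ∈ S, p K i) * ∏ i ∈ Finset.range (n K) \ S, (1 - p K i)|) / 2)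
      (fun K => div_nonneg (Finset.sum_nonneg fun S _ => abs_nonneg _) two_pos.le)
      (fun K => half_l1_prodConfig_lt_one (Finset.range (n K)) (hp K) (hq K)) (hsum.div_const 2)
      (fun K t _ S hS => by
        have h := abs_sub_le_half_sum_abs (Finset.range (n K)).powerset (a := fun S => (∏ i ∈ S, p K i) * ∏ i ∈ Finset.range (n K) \ S, (1 - p K i))
          (b := fun S => (∏ i ∈ S, q K i) * ∏ i ∈ Finset.range (n K) \ S, (1 - q K i)) (by rw [sum_prodConfig_eq_one, sum_prodConfig_eq_one]) hS
        rw [sum_prodConfig_eq_one, sum_prodConfig_eq_one, div_one, div_one, abs_sub_comm]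
        exact h)
    exact ⟨fun _ _ => ∅, fun _ => 0, shA, shB, _, fun _ => 0, h⟩

/-- ★★★ **THE BLOCK-DISCREPANCY LETTER SUFFICES — ANY BLOCK COUNTS, ANY REGIME** [folklore ∕ bookkeeping]: if the two runs' per-block large-field probabilities agree in ℓ¹ over
blocks, summably over scales, `Σ_K Σ_{i<n_K} |q_{K,i} − p_{K,i}| < ∞`, then SOME dials give `HybridNE7` (hence stub 2's face triple) on the caricature — by the hybrid bound
`ℓ¹_K ≤ 2·Σ_i |q_{K,i} − p_{K,i}|` and the exact criterion.  (FILE M's `exists_hybridNE7_caricature_of_summable_meanShift` is the constant-rate case, §3.) -/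
theorem exists_hybridNE7_inhomCaricature_of_summable_blockDiscrepancy (hp : ∀ K, ∀ i ∈ Finset.range (n K), 0 < p K i ∧ p K i < 1)
    (hq : ∀ K, ∀ i ∈ Finset.range (n K), 0 ≤ q K i ∧ q K i ≤ 1) {l₀ : ℝ} (hl₀ : 0 ≤ l₀) (vol : ℝ)
    (hsum : Summable fun K => ∑ i ∈ Finset.range (n K), |q K i - p K i|) :
    ∃ (Bad : ℕ → ℝ → Finset (Finset ℕ)) (W : ℕ → ℝ) (shA shB : ℕ → ℝ → Finset ℕ → ℝ) (Wsh δ : ℕ → ℝ),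
      HybridNE7 l₀ vol (fun K => (Finset.range (n K)).powerset) (fun K _ S => (∏ i ∈ S, p K i) * ∏ i ∈ Finset.range (n K) \ S, (1 - p K i))
        (fun K _ S => (∏ i ∈ S, q K i) * ∏ i ∈ Finset.range (n K) \ S, (1 - q K i)) Bad W shA shB Wsh δ := by
  have hp' : ∀ K, ∀ i ∈ Finset.range (n K), 0 ≤ p K i ∧ p K i ≤ 1 := fun K i hi => ⟨(hp K i hi).1.le, (hp K i hi).2.le⟩
  refine (exists_hybridNE7_inhomCaricature_iff_summable_l1 n p q hp hq hl₀ vol).2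
    (Summable.of_nonneg_of_le (fun K => Finset.sum_nonneg fun S _ => abs_nonneg _) (fun K => ?_) (hsum.mul_left 2))
  exact l1_prodConfig_le_two_mul_blockDiscrepancy (Finset.range (n K)) (hp' K) (hq K)

/-- ★★ **… AND IS NECESSARY IN THE RARE WINDOW** [folklore ∕ bookkeeping]: if under either run at most half a large-field block is expected at every scale (`Σ_i p_{K,i} ≤ ½`,
`Σ_i q_{K,i} ≤ ½`) and SOME dials give `HybridNE7` on the caricature, then `Σ_K Σ_{i<n_K} |q_{K,i} − p_{K,i}| < ∞` — by the rare-window lower bound and the exact criterion. -/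
theorem summable_blockDiscrepancy_of_exists_hybridNE7_of_rare (hp : ∀ K, ∀ i ∈ Finset.range (n K), 0 < p K i ∧ p K i < 1)
    (hq : ∀ K, ∀ i ∈ Finset.range (n K), 0 ≤ q K i ∧ q K i ≤ 1) {l₀ : ℝ} (hl₀ : 0 ≤ l₀) {vol : ℝ}
    (hrare : ∀ K, ∑ i ∈ Finset.range (n K), p K i ≤ 1 / 2 ∧ ∑ i ∈ Finset.range (n K), q K i ≤ 1 / 2)
    (h : ∃ (Bad : ℕ → ℝ → Finset (Finset ℕ)) (W : ℕ → ℝ) (shA shB : ℕ → ℝ → Finset ℕ → ℝ) (Wsh δ : ℕ → ℝ),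
      HybridNE7 l₀ vol (fun K => (Finset.range (n K)).powerset) (fun K _ S => (∏ i ∈ S, p K i) * ∏ i ∈ Finset.range (n K) \ S, (1 - p K i))
        (fun K _ S => (∏ i ∈ S, q K i) * ∏ i ∈ Finset.range (n K) \ S, (1 - q K i)) Bad W shA shB Wsh δ) :
    Summable fun K => ∑ i ∈ Finset.range (n K), |q K i - p K i| := by
  have hp' : ∀ K, ∀ i ∈ Finset.range (n K), 0 ≤ p K i ∧ p K i ≤ 1 := fun K i hi => ⟨(hp K i hi).1.le, (hp K i hi).2.le⟩
  refine Summable.of_nonneg_of_le (fun K => Finset.sum_nonneg fun i _ => abs_nonneg _) (fun K => ?_)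
    (((exists_hybridNE7_inhomCaricature_iff_summable_l1 n p q hp hq hl₀ vol).1 h).mul_left 2)
  exact blockDiscrepancy_le_two_mul_l1_prodConfig_of_rare (Finset.range (n K)) (hp' K) (hq K) (hrare K).1 (hrare K).2

/-- ★★★★ **THE RARE WINDOW IN CLOSED FORM** [folklore ∕ bookkeeping]: for per-block run-A rates in `(0, 1)`, run-B rates in `[0, 1]`, and at most half an expected large-field block under
either run at every scale, SOME dials give node U5's `HybridNE7` (hence K3 stub 2's face triple) on the independent-block caricature IFF
`Σ_K Σ_{i<n_K} |q_{K,i} − p_{K,i}| < ∞` — the two runs' large-field probabilities must agree BLOCK BY BLOCK in ℓ¹, summably over scales; no exchangeability, no count statistic. -/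
theorem exists_hybridNE7_inhomCaricature_iff_summable_blockDiscrepancy_of_rare (hp : ∀ K, ∀ i ∈ Finset.range (n K), 0 < p K i ∧ p K i < 1)
    (hq : ∀ K, ∀ i ∈ Finset.range (n K), 0 ≤ q K i ∧ q K i ≤ 1) {l₀ : ℝ} (hl₀ : 0 ≤ l₀) (vol : ℝ)
    (hrare : ∀ K, ∑ i ∈ Finset.range (n K), p K i ≤ 1 / 2 ∧ ∑ i ∈ Finset.range (n K), q K i ≤ 1 / 2) :
    (∃ (Bad : ℕ → ℝ → Finset (Finset ℕ)) (W : ℕ → ℝ) (shA shB : ℕ → ℝ → Finset ℕ → ℝ) (Wsh δ : ℕ → ℝ),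
      HybridNE7 l₀ vol (fun K => (Finset.range (n K)).powerset) (fun K _ S => (∏ i ∈ S, p K i) * ∏ i ∈ Finset.range (n K) \ S, (1 - p K i))
        (fun K _ S => (∏ i ∈ S, q K i) * ∏ i ∈ Finset.range (n K) \ S, (1 - q K i)) Bad W shA shB Wsh δ) ↔
    Summable fun K => ∑ i ∈ Finset.range (n K), |q K i - p K i| :=
  ⟨summable_blockDiscrepancy_of_exists_hybridNE7_of_rare n p q hp hq hl₀ hrare,
    exists_hybridNE7_inhomCaricature_of_summable_blockDiscrepancy n p q hp hq hl₀ vol⟩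

end AlongK

/-! ## §3 Dictionary with the exchangeable caricature (FILES A ∕ M) and an A6 witness -/

section Dictionary

/-- CONSTANT RATES GIVE FILE A's WEIGHTS: `(∏_{i∈S} p)·∏_{i ∈ range n ∖ S}(1 − p) = p^{#S}·(1 − p)^{n − #S}` for `S ⊆ range n`. [bookkeeping] -/
theorem prodConfig_const (p : ℝ) (n : ℕ) {S : Finset ℕ} (hS : S ⊆ Finset.range n) :
    (∏ _i ∈ S, p) * ∏ _i ∈ Finset.range n \ S, (1 - p) = p ^ S.card * (1 - p) ^ (n - S.card) := by
  rw [Finset.prod_const, Finset.prod_const, Finset.card_sdiff_of_subset hS, Finset.card_range]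

/-- CONSTANT RATES GIVE FILE M's LETTER: `Σ_{i<n} |q − p| = n·|q − p|` (the mean count shift `Δ = n|q − p|`). [bookkeeping] -/
theorem blockDiscrepancy_const (p q : ℝ) (n : ℕ) : ∑ _i ∈ Finset.range n, |q - p| = n * |q - p| := by
  rw [Finset.sum_const, Finset.card_range, nsmul_eq_mul]

/-- A6: the rare-window hypotheses of §2 are JOINTLY INHABITED by a non-trivial pair of rate arrays (one block per scale, `p ≡ ¼`, `q_K = ¼ + 2^{−K}∕8`). [bookkeeping] -/
theorem rareWindow_hypotheses_inhabited : ∃ (n : ℕ → ℕ) (p q : ℕ → ℕ → ℝ),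
    (∀ K, ∀ i ∈ Finset.range (n K), 0 < p K i ∧ p K i < 1) ∧ (∀ K, ∀ i ∈ Finset.range (n K), 0 ≤ q K i ∧ q K i ≤ 1) ∧
    (∀ K, ∑ i ∈ Finset.range (n K), p K i ≤ 1 / 2 ∧ ∑ i ∈ Finset.range (n K), q K i ≤ 1 / 2) ∧
    (Summable fun K => ∑ i ∈ Finset.range (n K), |q K i - p K i|) ∧ ∀ K, ∃ i ∈ Finset.range (n K), q K i ≠ p K i := by
  have hg : ∀ K : ℕ, (0 : ℝ) < (1 / 2) ^ K / 8 ∧ (1 / 2 : ℝ) ^ K / 8 ≤ 1 / 8 := fun K =>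
    ⟨by positivity, div_le_div_of_nonneg_right (pow_le_one₀ (by norm_num) (by norm_num)) (by norm_num)⟩
  refine ⟨fun _ => 1, fun _ _ => 1 / 4, fun K _ => 1 / 4 + (1 / 2) ^ K / 8, fun K i _ => ⟨by norm_num, by norm_num⟩,
    fun K i _ => ⟨by linarith [(hg K).1], by linarith [(hg K).2]⟩, fun K => ?_, ?_, fun K => ⟨0, by simp, by linarith [(hg K).1]⟩⟩
  · simp only [Finset.sum_range_one]; exact ⟨by norm_num, by linarith [(hg K).2]⟩
  · simp only [Finset.sum_range_one, add_sub_cancel_left]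
    exact ((summable_geometric_of_lt_one (by norm_num) (by norm_num)).div_const 8).congr fun K => (abs_of_pos (hg K).1).symm

end Dictionary

end Summit.QuantumFields.YangMills.BalabanUVNodes.N20InhomogeneousBlockCaricature

end
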